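import Summits.BirchSwinnertonDyer.BirchSwinnertonDyer.Theorems.SchneiderFreeAdditiveX3EndStateControlDischarged
import Summits.BirchSwinnertonDyer.Rank1Residual.X11b.FrameIdealRigidity
import HarnessLib

/-!
# Route `SchneiderFreeAdditiveX3Upper` (K1 wing): its two analytic co-cruxes `GordTwoBranchCoIMCField` (20365) and
# `PotMultBranchCoIMC` (20366) from Kolyvagin, TWO REFEREED INPUTS (Hsieh 2014 Thm A any level; Liu–Zhang–Zhang 2018 Thm
# 1.5.1/1.5.3 additive) and ONE typed analytic half — the ♭-CO-DIVISIBILITY `(Q) ⊆ Ch_Λ(X_ac^∅)·𝓞_{ℂ_p}⟦T⟧` at ONE frame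

Cell `bsd-schneider-ideate`, seat `bsd-schneider-door-c5` (prover, generation 19; assembly layer).  PARTITION: board row
B6 ∩ X3 ∩ sst-twist, `r = 1` (7 101 pairs), of `Rank1Residual.partition` — the WING (upper half `ord_p #Ш ≤ ord_p #Ш_an`);
types-the-object-of nothing new; closes none of B6's cells.  bears_on: K1-wing (route-BirchSwinnertonDyer-SchneiderFreeAdditiveX3Upper
items 20365 / 20366) and K1-door r3 19177 (same frames; FINDING-door-c5-g19 §2).

WHAT.  The MIRROR IMAGE of bsd-potss-kmc g19's `additiveIMCLowerBDPInputManinAt_of_pt_of_kolyvagin_of_hsieh_of_lzz_of_intDiv`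
(p546778) for the wing's UPPER socket `Upper.AdditiveIMCUpperBDPInputManinAt W p` (co-T-B6-1♯: `n + 2·v_p(c) ≤ 2·ord_p log_ω P`
where `Ch_Λ(X_ac^∅) = (f)`, `ord_p f(0) = n`): CTL₀ (Poitou–Tate (i), a tree theorem, + Kolyvagin) gives `n`; an embedding datum
`ι′` induces `𝔭`; Hsieh 2014 Thm A (any level) gives a ♭-frame `Q ∈ 𝓞_{ℂ_p}⟦T⟧` of `Dt.f` at `(ι′, 𝔭)`; Liu–Zhang–Zhang pins
`Q(0) = u·(log_ω P / c)²` with `‖u‖ = 1` (`UniversalToricDescentWaldspurgerFlat.intSeries_value_of_frame_tors` — a UNIT cofactor,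
which is what an UPPER bound needs and what the Castella–Hsieh road had to read off scope, `KYRead.KYReadCHValueUnitOffScope`);
the displayed ♭-CO-divisibility `(Q) ⊆ (f)·𝓞_{ℂ_p}⟦T⟧` gives `‖Q(0)‖ ≤ ‖f(0)‖`, i.e. `n ≤ 2·ord_p(log_ω P / c)`.  So, exactly as on
the door, the wing's two analytic co-cruxes need from the analytic side ONLY

  H3♭ᵒᵖ(W, p): over the upper socket's binders (incl. `E(K)[p] = 0`), for every `ι′` inducing `𝔭` and every / one ♭-frame
  `(Ω_K ≠ 0, Ω_p ≠ 0, Q)` with `X11b.R1.IsBDPLFunctionInt p ι′ 𝔭 κ γ Dt.f Ω_K Ω_p Q`: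
  `Ideal.span {Q} ≤ (XAc.charIdeal (W.baseChange K) p κ 𝔭 ∅ γ).map (PowerSeries.map (X11b.R1.toCpInt p))`

(the Kolyvagin / EQUALITY half of a branch main conjecture read at a frame of `f_E`; on (G-ord, `e = 2`) Keller–Yin Thm. 3.5.1
(iii) — PREPRINT — at a MATCHED branch frame; on (M) not in print).  By x11b3's ideal rigidity across periods one frame suffices.

* §1 `additiveIMCUpperBDPInputManinAt_of_kolyvagin_of_hsieh_of_lzz_of_intCoDiv` — the class-wide upper socket on a pair of the
  cell from `hKo`, `hA`, `hL` and H3♭ᵒᵖ (∀-frame form).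
* §2 the wing cruxes BY NAME: `potMultBranchCoIMC_of_kolyvagin_of_hsieh_of_lzz_of_intCoDiv`,
  `gordTwoBranchCoIMCField_of_kolyvagin_of_hsieh_of_lzz_of_intCoDiv` (the rational-line and `d_K ≠ −3` binders are not used).
* §3 the ∃-frame forms: `span_le_ideal_of_exists_frame`, `intCoDiv_of_exists_frame`, and the two cruxes from H3♭ᵒᵖ∃.

HONEST FRAMING: THEOREMS ONLY (no definition, no named fact, no `sorry`); every statement CONDITIONAL on its displayed hypotheses;
the co-divisibility is NOT in print on (M) and rests on a preprint + an untyped matching on (G-ord); nothing is closed; BSD is proved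
for no curve; «closes rung: none».
References: [JetchevSkinnerWan2017] §7.4.1 (arXiv:1512.06894 p. 30); [Hsieh2014] Thm. A; [LiuZhangZhang2018] Thm 1.5.1/1.5.3;
[Castella2018] Thm. 3.1; [KellerYin2024b] arXiv:2410.23241 Thm. 3.5.1 (preprint; shape only).
-/

set_option autoImplicit false
-- `Summit.<P>.<Sub>` repeats `BirchSwinnertonDyer` by the tree's layout convention (D-0017)
set_option linter.dupNamespace false

noncomputable section

open scoped Classical NumberField

open Field NumberField IsDedekindDomain WeierstrassCurve PowerSeries
  Literature.NumberTheory.EllipticCurves Literature.NumberTheory.EllipticCurves.GreenbergSelmer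
  Literature.NumberTheory.GaloisRepresentations Literature.NumberTheory.GaloisCohomology
  Literature.NumberTheory.EllipticCurves.ModularForms Literature.NumberTheory.EllipticCurves.Rank1Residual
  Summit.BirchSwinnertonDyer.Rank1Residual Summit.BirchSwinnertonDyer.Rank1Residual.X11b
  Summit.BirchSwinnertonDyer.Rank1Residual.X11b.AcSelmer Summit.BirchSwinnertonDyer.Rank1Residual.X11b.Halves
  Summit.BirchSwinnertonDyer.Rank1Residual.X11b.CongruenceLimit
  Summit.BirchSwinnertonDyer.BirchSwinnertonDyer.Theorems.SchneiderFree
  Summit.BirchSwinnertonDyer.BirchSwinnertonDyer.Theorems.SchneiderFree.Upper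
  Summit.BirchSwinnertonDyer.BirchSwinnertonDyer.Theses.SchneiderFreeAdditiveX3

open Summit.BirchSwinnertonDyer.BirchSwinnertonDyer.Theses.SchneiderFreeAdditiveX3Upper
  (GordTwoBranchCoIMCField PotMultBranchCoIMC)

namespace Summit.BirchSwinnertonDyer.BirchSwinnertonDyer.Theorems.SchneiderFreeAdditiveX3.ControlDischarged

/-! ### §1 The upper socket from two refereed inputs and the ♭-co-divisibility -/

/-- **The UPPER socket `Upper.AdditiveIMCUpperBDPInputManinAt W p` from Kolyvagin, Hsieh (any level), LZZ (additive) and the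
♭-CO-DIVISIBILITY only** (`p ≠ 2`, `ClassX3 W p`, `SubSemistableTwist W p`; Poitou–Tate (i) is the tree theorem behind
`pt_selmer_forall`).  For every datum of the socket and every frame `(κ, γ, 𝔭)`: CTL₀ gives `n` with `Ch_Λ(X_ac^∅) = (f)`,
`ord_p f(0) = n`; `ι′` induces `𝔭`; Hsieh gives a ♭-frame `Q` of `Dt.f`; LZZ pins `Q(0) = u·(log_ω P / c)²` with `‖u‖ = 1`; the displayed
co-divisibility puts `Q` in `(f)·𝓞_{ℂ_p}⟦T⟧`; norms give `‖log_ω P / c‖² = ‖Q(0)‖ ≤ ‖f(0)‖`, i.e. `n + 2·v_p(c) ≤ 2·ord_p log_ω P`.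
Mirror of bsd-potss-kmc's lower socket theorem.  CONDITIONAL on `hKo`, `hA`, `hL`, `hCoDiv`; nothing asserted about any curve.
[cite: JetchevSkinnerWan2017, §7.4.1 (arXiv:1512.06894 p. 30)] [cite: Hsieh2014, Thm. A p. 712 (Doc. Math. 19)]
[cite: LiuZhangZhang2018, Thm 1.5.1 and Thm 1.5.3 (Duke Math. J. 167 pp. 748–749)] -/
theorem additiveIMCUpperBDPInputManinAt_of_kolyvagin_of_hsieh_of_lzz_of_intCoDiv
    (hKo : ∀ (N : ℕ) [NeZero N] (W : WeierstrassCurve ℚ) (K : Type) [Field K] [NumberField K],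
      Literature.NumberTheory.EllipticCurves.kolyvagin N W K)
    (hA : Hsieh2014.thmA_exists_isHsiehLFunction_unrPeriod_anyLevel)
    (hL : LiuZhangZhang2018.thm151_thm153_modularCurve_heegnerVector_additive)
    {W : WeierstrassCurve ℚ} [W.IsElliptic] [W.IsGloballyMinimal] {p : ℕ} [Fact p.Prime]
    (hp2 : p ≠ 2) (hX : ClassX3 W p) (hS : Additive.SubSemistableTwist W p)
    (hCoDiv : ∀ (N : ℕ) [NeZero N] (K : Type) [Field K] [NumberField K]
      (Dt : ModularParametrizationData W N) (H : HeegnerDatum N (NumberField.discr K)) (ι : K →+* ℂ)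
      (P : (W.baseChange K).toAffine.Point),
      W.analyticRank = 1 → Additive.N10.Locus W p → W.conductorNorm ℤ = N → IsImaginaryQuadratic K →
      Odd (NumberField.discr K) → ¬ p ∣ Units.torsionOrder K → SatisfiesHeegnerHypothesis N K →
      (W.quadraticTwist (NumberField.discr K : ℚ)).entireLFunction 1 ≠ 0 →
      WeierstrassCurve.Affine.Point.map ι.toRatAlgHom P = heegnerPointComplex Dt H →
      ¬ IsOfFinAddOrder P → (∀ Q : (W.baseChange K).toAffine.Point, p • Q = 0 → Q = 0) →
      ∀ (κ : ZpExtension K p), κ.IsAnticyclotomic →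
        ∀ (γ : Field.absoluteGaloisGroup K) [Fact (κ.IsTopGenerator γ)]
          (𝔭 : HeightOneSpectrum (𝓞 K)), ((p : ℕ) : 𝓞 K) ∈ 𝔭.asIdeal →
          𝔭.asIdeal.ramificationIdx (𝓞 ℚ) = 1 → 𝔭.asIdeal.inertiaDeg (𝓞 ℚ) = 1 →
          ∀ (ι' : PadicAlgCl p ≃+* ℂ), BranchInducesPrime p ι' 𝔭 →
            ∀ (ΩK : ℂ) (Ωp : ℂ_[p]) (Q : PowerSeries (PadicComplexInt p)), ΩK ≠ 0 → Ωp ≠ 0 →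
              R1.IsBDPLFunctionInt p ι' 𝔭 κ γ Dt.f ΩK Ωp Q →
                Ideal.span {Q} ≤
                  (XAc.charIdeal (W.baseChange K) p κ 𝔭 ∅ γ).map (PowerSeries.map (R1.toCpInt p))) :
    Upper.AdditiveIMCUpperBDPInputManinAt W p := by
  intro N _ K _ _ Dt H ι P hr' hloc hN hK hodd hunit hHe hL1 hP hnt hnoT κ hκ γ _ 𝔭 h𝔭 he hf
  have hp : p.Prime := Fact.out
  have hγ : κ.IsTopGenerator γ := Fact.out
  -- CTL₀: the characteristic ideal is principal with `ord_p f(0) = n`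
  obtain ⟨n, hn⟩ := exists_hasCharValuationAt_of_pt_of_kolyvagin pt_selmer_forall hKo W p hr' hp2 hX hS N K Dt H ι P
    hr' hloc hN hK hodd hunit hHe hL1 hP hnt κ hκ γ 𝔭 h𝔭 he hf
  -- `p² ∣ N`
  have haddv : Addv W p := hloc.2.1
  have hp2N : p ^ 2 ∣ N := by
    by_contra h
    rw [← hN] at h
    rcases hasGoodReductionAtPrime_or_hasMultiplicativeReductionAtPrime_of_not_sq_dvd_conductorNorm (V := W) h
      with hg | hm
    · exact haddv.1 hg
    · exact haddv.2 hm
  have hpN : p ∣ N := dvd_trans (dvd_pow_self p two_ne_zero) hp2N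
  have hsplit : ((Ideal.span {(p : ℤ)}).primesOver (𝓞 K)).ncard = 2 := hHe p hp hpN
  -- an embedding datum inducing `𝔭` and the ♭-frame of `Dt.f` there (Hsieh, any level)
  obtain ⟨ι₀⟩ := PadicAlgCl.nonempty_ringEquiv_complex p
  obtain ⟨ι', -, hι'⟩ := exists_datum_forall_mem_iff p ι₀ hK h𝔭
  obtain ⟨lam, rlam, hlu, hinfl, hAQ, hunrl, havl, hfacl⟩ := lambdaSupplyAt hp2 ι' K κ hK hκ
  subst hN
  obtain ⟨A, ΩK₀, C, Ωp, Q₀, hA0, hΩK₀, hC, hQ₀⟩ :=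
    hA ι' K 𝔭 κ γ Dt.f lam rlam hp2 Dt.isNewformOf.1 hK hsplit h𝔭 hι' hHe hlu hinfl hAQ hunrl havl hfacl hκ hγ
  obtain ⟨ΩK, c, hΩK, -, hQ⟩ :=
    exists_isBDPLFunctionInt_of_isHsiehLFunction ι' 𝔭 κ γ Dt.f hpN hA0 hΩK₀ hC ((Ωp : unrIntegers p) : ℂ_[p]) hQ₀
  have hΩp : ((Ωp : unrIntegers p) : ℂ_[p]) ≠ 0 := fun h0 ↦ by
    have h1 := norm_coe_units_unrIntegers p Ωp
    rw [h0, norm_zero] at h1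
    exact zero_ne_one h1
  set Q : PowerSeries (PadicComplexInt p) := PowerSeries.C c * Q₀ with hQdef
  -- the value of the frame at `𝟙` (LZZ, `‖u‖ = 1`)
  obtain ⟨u, hu, hval⟩ :=
    UniversalToricDescentWaldspurgerFlat.intSeries_value_of_frame_tors hL W K 𝔭 κ γ Dt H ι P Dt.f Dt.isNewformOf
      hp2 rfl hp2N hK hunit h𝔭 he hf hHe hκ hP hnt ι' hι' hΩK hΩp hQ
  -- the ♭-co-divisibility at this frame
  have hcodiv := hCoDiv (W.conductorNorm ℤ) K Dt H ι P hr' hloc rfl hK hodd hunit hHe hL1 hP hnt hnoT κ hκ γ 𝔭 h𝔭 he hf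
    ι' hι' ΩK _ Q hΩK hΩp hQ
  -- the upper norm half over `𝓞_{ℂ_p}⟦T⟧`
  obtain ⟨htors, f, hfI, hf0, hfn⟩ := hn
  have hmem : Q ∈ Ideal.span {PowerSeries.map (R1.toCpInt p) f} := by
    have h3 := hcodiv
    rw [hfI, map_span_singleton_powerSeries] at h3
    exact (Ideal.span_singleton_le_iff_mem _).mp h3
  set x : ℚ_[p] := logOmega W p (embAt K p 𝔭 h𝔭 he hf) P / (Dt.c : ℚ_[p]) with hx
  have hQ0 : u * (algebraMap ℚ_[p] ℂ_[p] x) ^ 2 = ((constantCoeff Q : PadicComplexInt p) : ℂ_[p]) :=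
    R1.intSeries_eq_constantCoeff_of_hasValueAt_zero p hval
  obtain ⟨G, hG⟩ := Ideal.mem_span_singleton'.mp hmem
  have hfac : ((constantCoeff Q : PadicComplexInt p) : ℂ_[p]) =
      ((constantCoeff G : PadicComplexInt p) : ℂ_[p]) * algebraMap ℚ_[p] ℂ_[p] ((constantCoeff f : ℤ_[p]) : ℚ_[p]) := by
    rw [← R1.coe_toCpInt, ← constantCoeff_map_apply (R1.toCpInt p) f, ← hG, map_mul, MulMemClass.coe_mul]
  have hp1 : (1 : ℝ) < p := by exact_mod_cast hp.one_lt
  have hnormf : ‖x‖ ^ 2 ≤ ‖((constantCoeff f : ℤ_[p]) : ℚ_[p])‖ := by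
    calc ‖x‖ ^ 2
        = ‖u‖ * ‖algebraMap ℚ_[p] ℂ_[p] x‖ ^ 2 := by rw [hu, one_mul, norm_algebraMap']
      _ = ‖((constantCoeff Q : PadicComplexInt p) : ℂ_[p])‖ := by rw [← hQ0, norm_mul, norm_pow]
      _ = ‖((constantCoeff G : PadicComplexInt p) : ℂ_[p])‖ *
            ‖algebraMap ℚ_[p] ℂ_[p] ((constantCoeff f : ℤ_[p]) : ℚ_[p])‖ := by rw [hfac, norm_mul]
      _ ≤ 1 * ‖algebraMap ℚ_[p] ℂ_[p] ((constantCoeff f : ℤ_[p]) : ℚ_[p])‖ :=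
          mul_le_mul_of_nonneg_right (R1.norm_coe_padicComplexInt_le_one p _) (norm_nonneg _)
      _ = ‖((constantCoeff f : ℤ_[p]) : ℚ_[p])‖ := by rw [one_mul, norm_algebraMap']
  -- `x ≠ 0`
  have hlog : logOmega W p (embAt K p 𝔭 h𝔭 he hf) P ≠ 0 := R1.logOmega_ne_zero W p _ hnt
  have hc0 : Dt.c ≠ 0 := Dt.maninConstant_ne_zero_holds
  have hc0' : (Dt.c : ℚ_[p]) ≠ 0 := by exact_mod_cast hc0
  have hx0 : x ≠ 0 := div_ne_zero hlog hc0'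
  -- norms to valuations: `ord_p f(0) = n ≤ 2·ord_p x`
  rw [← PadicInt.norm_def, PadicInt.norm_eq_zpow_neg_valuation hf0, Padic.norm_eq_zpow_neg_valuation hx0] at hnormf
  have hlhs : ((p : ℝ) ^ (-x.valuation)) ^ 2 = (p : ℝ) ^ (-(2 * x.valuation)) := by
    rw [← zpow_natCast ((p : ℝ) ^ (-x.valuation)) 2, ← zpow_mul]
    congr 1
    push_cast
    ring
  rw [hlhs, zpow_le_zpow_iff_right₀ hp1] at hnormf
  have hle : ((constantCoeff f).valuation : ℤ) ≤ 2 * x.valuation := by omega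
  rw [hx, div_eq_mul_inv, Padic.valuation_mul hlog (inv_ne_zero hc0'), Padic.valuation_inv,
    Padic.valuation_intCast, valuation_logOmega hlog, hfn] at hle
  refine ⟨n, ⟨htors, f, hfI, hf0, hfn⟩, ?_⟩
  simp only [padicValInt] at hle
  linarith

/-! ### §2 The wing's two co-cruxes by name -/

/-- **Wing crux r4 `PotMultBranchCoIMC` (item 20366) ⇐ Kolyvagin ∧ Hsieh 2014 Thm. A (any level) ∧ Liu–Zhang–Zhang 2018 (additive) ∧
H3♭ᵒᵖ on the (M) cell** (the co-divisibility at every ♭-frame, displayed hypothesis `hM`; the crux's rational-line binder is not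
used).  CONDITIONAL; on (M) no divisibility is in print. [cite: Hsieh2014, Thm. A p. 712 (Doc. Math. 19)]
[cite: LiuZhangZhang2018, Thm 1.5.1 and Thm 1.5.3 (Duke Math. J. 167 pp. 748–749)]
[cite: KellerYin2024b, §3.1 Case II (arXiv:2410.23241 pp. 13–15) (scope statement only)] -/
theorem potMultBranchCoIMC_of_kolyvagin_of_hsieh_of_lzz_of_intCoDiv
    (hKo : ∀ (N : ℕ) [NeZero N] (W : WeierstrassCurve ℚ) (K : Type) [Field K] [NumberField K],
      Literature.NumberTheory.EllipticCurves.kolyvagin N W K)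
    (hA : Hsieh2014.thmA_exists_isHsiehLFunction_unrPeriod_anyLevel)
    (hL : LiuZhangZhang2018.thm151_thm153_modularCurve_heegnerVector_additive)
    (hM : ∀ (W : WeierstrassCurve ℚ) [W.IsElliptic] [W.IsGloballyMinimal] (p : ℕ) [Fact p.Prime],
      p ≠ 2 → ClassX3 W p → Additive.SubM W p →
      ∀ (N : ℕ) [NeZero N] (K : Type) [Field K] [NumberField K]
        (Dt : ModularParametrizationData W N) (H : HeegnerDatum N (NumberField.discr K)) (ι : K →+* ℂ)
        (P : (W.baseChange K).toAffine.Point),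
        W.analyticRank = 1 → Additive.N10.Locus W p → W.conductorNorm ℤ = N → IsImaginaryQuadratic K →
        Odd (NumberField.discr K) → ¬ p ∣ Units.torsionOrder K → SatisfiesHeegnerHypothesis N K →
        (W.quadraticTwist (NumberField.discr K : ℚ)).entireLFunction 1 ≠ 0 →
        WeierstrassCurve.Affine.Point.map ι.toRatAlgHom P = heegnerPointComplex Dt H →
        ¬ IsOfFinAddOrder P → (∀ Q : (W.baseChange K).toAffine.Point, p • Q = 0 → Q = 0) →
        ∀ (κ : ZpExtension K p), κ.IsAnticyclotomic →
          ∀ (γ : Field.absoluteGaloisGroup K) [Fact (κ.IsTopGenerator γ)]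
            (𝔭 : HeightOneSpectrum (𝓞 K)), ((p : ℕ) : 𝓞 K) ∈ 𝔭.asIdeal →
            𝔭.asIdeal.ramificationIdx (𝓞 ℚ) = 1 → 𝔭.asIdeal.inertiaDeg (𝓞 ℚ) = 1 →
            ∀ (ι' : PadicAlgCl p ≃+* ℂ), BranchInducesPrime p ι' 𝔭 →
              ∀ (ΩK : ℂ) (Ωp : ℂ_[p]) (Q : PowerSeries (PadicComplexInt p)), ΩK ≠ 0 → Ωp ≠ 0 →
                R1.IsBDPLFunctionInt p ι' 𝔭 κ γ Dt.f ΩK Ωp Q →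
                  Ideal.span {Q} ≤
                    (XAc.charIdeal (W.baseChange K) p κ 𝔭 ∅ γ).map (PowerSeries.map (R1.toCpInt p))) :
    PotMultBranchCoIMC := by
  intro W _ _ p _ hp2 hX hSM _
  exact additiveIMCUpperBDPInputManinAt_of_kolyvagin_of_hsieh_of_lzz_of_intCoDiv hKo hA hL hp2 hX (Or.inl hSM)
    (hM W p hp2 hX hSM)

/-- **Wing crux r3 `GordTwoBranchCoIMCField` (item 20365) ⇐ Kolyvagin ∧ Hsieh 2014 Thm. A (any level) ∧ Liu–Zhang–Zhang 2018
(additive) ∧ H3♭ᵒᵖ on the (G-ord, `e = 2`) cell** (displayed hypothesis `hG`; the crux's rational-line and `d_K ≠ −3` binders are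
not used — LZZ's value needs neither).  Its co-divisibility is Keller–Yin Thm. 3.5.1 (iii) (PREPRINT) read at a MATCHED frame of
`f_E` (the matching is NOT in the tree, FINDING-door-c5-g19 §2).  CONDITIONAL; nothing closed.
[cite: Hsieh2014, Thm. A p. 712 (Doc. Math. 19)] [cite: LiuZhangZhang2018, Thm 1.5.1 and Thm 1.5.3 (Duke Math. J. 167 pp. 748–749)]
[cite: KellerYin2024b, Thm. 3.5.1 (arXiv:2410.23241 p. 20) (shape; preprint)] -/
theorem gordTwoBranchCoIMCField_of_kolyvagin_of_hsieh_of_lzz_of_intCoDiv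
    (hKo : ∀ (N : ℕ) [NeZero N] (W : WeierstrassCurve ℚ) (K : Type) [Field K] [NumberField K],
      Literature.NumberTheory.EllipticCurves.kolyvagin N W K)
    (hA : Hsieh2014.thmA_exists_isHsiehLFunction_unrPeriod_anyLevel)
    (hL : LiuZhangZhang2018.thm151_thm153_modularCurve_heegnerVector_additive)
    (hG : ∀ (W : WeierstrassCurve ℚ) [W.IsElliptic] [W.IsGloballyMinimal] (p : ℕ) [Fact p.Prime],
      p ≠ 2 → ClassX3 W p → Additive.SubGordTwo W p →
      ∀ (N : ℕ) [NeZero N] (K : Type) [Field K] [NumberField K]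
        (Dt : ModularParametrizationData W N) (H : HeegnerDatum N (NumberField.discr K)) (ι : K →+* ℂ)
        (P : (W.baseChange K).toAffine.Point),
        W.analyticRank = 1 → Additive.N10.Locus W p → W.conductorNorm ℤ = N → IsImaginaryQuadratic K →
        Odd (NumberField.discr K) → ¬ p ∣ Units.torsionOrder K → SatisfiesHeegnerHypothesis N K →
        (W.quadraticTwist (NumberField.discr K : ℚ)).entireLFunction 1 ≠ 0 →
        WeierstrassCurve.Affine.Point.map ι.toRatAlgHom P = heegnerPointComplex Dt H →
        ¬ IsOfFinAddOrder P → (∀ Q : (W.baseChange K).toAffine.Point, p • Q = 0 → Q = 0) →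
        ∀ (κ : ZpExtension K p), κ.IsAnticyclotomic →
          ∀ (γ : Field.absoluteGaloisGroup K) [Fact (κ.IsTopGenerator γ)]
            (𝔭 : HeightOneSpectrum (𝓞 K)), ((p : ℕ) : 𝓞 K) ∈ 𝔭.asIdeal →
            𝔭.asIdeal.ramificationIdx (𝓞 ℚ) = 1 → 𝔭.asIdeal.inertiaDeg (𝓞 ℚ) = 1 →
            ∀ (ι' : PadicAlgCl p ≃+* ℂ), BranchInducesPrime p ι' 𝔭 →
              ∀ (ΩK : ℂ) (Ωp : ℂ_[p]) (Q : PowerSeries (PadicComplexInt p)), ΩK ≠ 0 → Ωp ≠ 0 →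
                R1.IsBDPLFunctionInt p ι' 𝔭 κ γ Dt.f ΩK Ωp Q →
                  Ideal.span {Q} ≤
                    (XAc.charIdeal (W.baseChange K) p κ 𝔭 ∅ γ).map (PowerSeries.map (R1.toCpInt p))) :
    GordTwoBranchCoIMCField := by
  intro W _ _ p _ hp2 hX hSG _ K _ _ _ _
  exact additiveIMCUpperBDPInputManinAtField_of_inputManinAt
    (additiveIMCUpperBDPInputManinAt_of_kolyvagin_of_hsieh_of_lzz_of_intCoDiv hKo hA hL hp2 hX (Or.inr hSG)
      (hG W p hp2 hX hSG)) K

/-! ### §3 The ∃-frame forms (one ♭-frame per datum) -/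

/-- **`(Q₀) ≤ I` for ONE ♭-frame `Q₀` gives `(Q) ≤ I` for EVERY ♭-frame `Q`** of the same `(ι, 𝔭, κ, γ, f)` (odd `p`, `K` imaginary
quadratic, `κ` anticyclotomic with topological generator `γ`, non-zero periods): `(Q) = (Q₀)` by x11b3's
`R1.span_singleton_eq_of_isBDPLFunctionInt`. [cite: Castella2018, Thm. 3.1 (arXiv:1704.06608 p. 9)] -/
theorem span_le_ideal_of_exists_frame {p : ℕ} [Fact p.Prime] (hp2 : p ≠ 2) {K : Type} [Field K] [NumberField K]
    (hK : IsImaginaryQuadratic K) {N : ℕ} {ι : PadicAlgCl p ≃+* ℂ} {𝔭 : HeightOneSpectrum (𝓞 K)}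
    {κ : ZpExtension K p} (hκ : κ.IsAnticyclotomic) {γ : Field.absoluteGaloisGroup K} (hγ : κ.IsTopGenerator γ)
    {f : CuspForm (CongruenceSubgroup.Gamma0 N) 2} {I : Ideal (PowerSeries 𝓞_ℂ_[p])}
    (h : ∃ (ΩK₀ : ℂ) (Ωp₀ : ℂ_[p]) (Q₀ : PowerSeries 𝓞_ℂ_[p]), ΩK₀ ≠ 0 ∧ Ωp₀ ≠ 0 ∧
      R1.IsBDPLFunctionInt p ι 𝔭 κ γ f ΩK₀ Ωp₀ Q₀ ∧ Ideal.span {Q₀} ≤ I)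
    {ΩK : ℂ} {Ωp : ℂ_[p]} {Q : PowerSeries 𝓞_ℂ_[p]} (hΩK : ΩK ≠ 0) (hΩp : Ωp ≠ 0)
    (hQ : R1.IsBDPLFunctionInt p ι 𝔭 κ γ f ΩK Ωp Q) : Ideal.span {Q} ≤ I := by
  obtain ⟨ΩK₀, Ωp₀, Q₀, hΩK₀, hΩp₀, hQ₀, hI⟩ := h
  rw [R1.span_singleton_eq_of_isBDPLFunctionInt hp2 hK hκ hγ hΩK₀ hΩK hΩp₀ hΩp hQ₀ hQ]
  exact hI

/-- **H3♭ᵒᵖ ⇐ H3♭ᵒᵖ∃ on any cell.** Over the binders of the upper socket restricted to a cell predicate `Cell W p`: if at every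
datum and every `ι′` inducing `𝔭` there is ONE ♭-frame `Q₀` (non-zero periods) with `(Q₀) ⊆ Ch_Λ(X_ac^∅)·𝓞_{ℂ_p}⟦T⟧`, then the
co-divisibility holds at EVERY ♭-frame — the hypothesis `hM` / `hG` of §2 VERBATIM.  Conditional; nothing asserted about any curve.
[cite: Castella2018, Thm. 3.1 (arXiv:1704.06608 p. 9)] [cite: JetchevSkinnerWan2017, §7.4.1 (arXiv:1512.06894 p. 30) (socket shape)] -/
theorem intCoDiv_of_exists_frame
    (Cell : ∀ (W : WeierstrassCurve ℚ) [W.IsElliptic] [W.IsGloballyMinimal] (p : ℕ) [Fact p.Prime], Prop)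
    (hEx : ∀ (W : WeierstrassCurve ℚ) [W.IsElliptic] [W.IsGloballyMinimal] (p : ℕ) [Fact p.Prime],
      p ≠ 2 → ClassX3 W p → Cell W p →
      ∀ (N : ℕ) [NeZero N] (K : Type) [Field K] [NumberField K]
        (Dt : ModularParametrizationData W N) (H : HeegnerDatum N (NumberField.discr K)) (ι : K →+* ℂ)
        (P : (W.baseChange K).toAffine.Point),
        W.analyticRank = 1 → Additive.N10.Locus W p → W.conductorNorm ℤ = N → IsImaginaryQuadratic K →
        Odd (NumberField.discr K) → ¬ p ∣ Units.torsionOrder K → SatisfiesHeegnerHypothesis N K →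
        (W.quadraticTwist (NumberField.discr K : ℚ)).entireLFunction 1 ≠ 0 →
        WeierstrassCurve.Affine.Point.map ι.toRatAlgHom P = heegnerPointComplex Dt H →
        ¬ IsOfFinAddOrder P → (∀ Q : (W.baseChange K).toAffine.Point, p • Q = 0 → Q = 0) →
        ∀ (κ : ZpExtension K p), κ.IsAnticyclotomic →
          ∀ (γ : Field.absoluteGaloisGroup K) [Fact (κ.IsTopGenerator γ)]
            (𝔭 : HeightOneSpectrum (𝓞 K)), ((p : ℕ) : 𝓞 K) ∈ 𝔭.asIdeal →
            𝔭.asIdeal.ramificationIdx (𝓞 ℚ) = 1 → 𝔭.asIdeal.inertiaDeg (𝓞 ℚ) = 1 →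
            ∀ (ι' : PadicAlgCl p ≃+* ℂ), BranchInducesPrime p ι' 𝔭 →
              ∃ (ΩK : ℂ) (Ωp : ℂ_[p]) (Q : PowerSeries (PadicComplexInt p)), ΩK ≠ 0 ∧ Ωp ≠ 0 ∧
                R1.IsBDPLFunctionInt p ι' 𝔭 κ γ Dt.f ΩK Ωp Q ∧
                  Ideal.span {Q} ≤
                    (XAc.charIdeal (W.baseChange K) p κ 𝔭 ∅ γ).map (PowerSeries.map (R1.toCpInt p))) :
    ∀ (W : WeierstrassCurve ℚ) [W.IsElliptic] [W.IsGloballyMinimal] (p : ℕ) [Fact p.Prime],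
      p ≠ 2 → ClassX3 W p → Cell W p →
      ∀ (N : ℕ) [NeZero N] (K : Type) [Field K] [NumberField K]
        (Dt : ModularParametrizationData W N) (H : HeegnerDatum N (NumberField.discr K)) (ι : K →+* ℂ)
        (P : (W.baseChange K).toAffine.Point),
        W.analyticRank = 1 → Additive.N10.Locus W p → W.conductorNorm ℤ = N → IsImaginaryQuadratic K →
        Odd (NumberField.discr K) → ¬ p ∣ Units.torsionOrder K → SatisfiesHeegnerHypothesis N K →
        (W.quadraticTwist (NumberField.discr K : ℚ)).entireLFunction 1 ≠ 0 →
        WeierstrassCurve.Affine.Point.map ι.toRatAlgHom P = heegnerPointComplex Dt H →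
        ¬ IsOfFinAddOrder P → (∀ Q : (W.baseChange K).toAffine.Point, p • Q = 0 → Q = 0) →
        ∀ (κ : ZpExtension K p), κ.IsAnticyclotomic →
          ∀ (γ : Field.absoluteGaloisGroup K) [Fact (κ.IsTopGenerator γ)]
            (𝔭 : HeightOneSpectrum (𝓞 K)), ((p : ℕ) : 𝓞 K) ∈ 𝔭.asIdeal →
            𝔭.asIdeal.ramificationIdx (𝓞 ℚ) = 1 → 𝔭.asIdeal.inertiaDeg (𝓞 ℚ) = 1 →
            ∀ (ι' : PadicAlgCl p ≃+* ℂ), BranchInducesPrime p ι' 𝔭 →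
              ∀ (ΩK : ℂ) (Ωp : ℂ_[p]) (Q : PowerSeries (PadicComplexInt p)), ΩK ≠ 0 → Ωp ≠ 0 →
                R1.IsBDPLFunctionInt p ι' 𝔭 κ γ Dt.f ΩK Ωp Q →
                  Ideal.span {Q} ≤
                    (XAc.charIdeal (W.baseChange K) p κ 𝔭 ∅ γ).map (PowerSeries.map (R1.toCpInt p)) := by
  intro W _ _ p _ hp2 hX hC N _ K _ _ Dt H ι P hr' hloc hN hK hodd hunit hHe hL1 hP hnt hnoT κ hκ γ hγ 𝔭 h𝔭 he hf
    ι' hι' ΩK Ωp Q hΩK hΩp hQ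
  exact span_le_ideal_of_exists_frame hp2 hK hκ hγ.out
    (hEx W p hp2 hX hC N K Dt H ι P hr' hloc hN hK hodd hunit hHe hL1 hP hnt hnoT κ hκ γ 𝔭 h𝔭 he hf ι' hι') hΩK hΩp hQ

/-- **Wing crux r4 `PotMultBranchCoIMC` ⇐ Kolyvagin ∧ Hsieh ∧ LZZ ∧ H3♭ᵒᵖ∃ on the (M) cell** (ONE ♭-frame per datum with the
co-divisibility): §3 with `Cell := Additive.SubM` fed to §2. CONDITIONAL; on (M) no divisibility is in print.
[cite: Hsieh2014, Thm. A p. 712 (Doc. Math. 19)] [cite: LiuZhangZhang2018, Thm 1.5.1 and Thm 1.5.3 (Duke Math. J. 167 pp. 748–749)] -/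
theorem potMultBranchCoIMC_of_kolyvagin_of_hsieh_of_lzz_of_exists_intCoDiv
    (hKo : ∀ (N : ℕ) [NeZero N] (W : WeierstrassCurve ℚ) (K : Type) [Field K] [NumberField K],
      Literature.NumberTheory.EllipticCurves.kolyvagin N W K)
    (hA : Hsieh2014.thmA_exists_isHsiehLFunction_unrPeriod_anyLevel)
    (hL : LiuZhangZhang2018.thm151_thm153_modularCurve_heegnerVector_additive)
    (hM : ∀ (W : WeierstrassCurve ℚ) [W.IsElliptic] [W.IsGloballyMinimal] (p : ℕ) [Fact p.Prime],
      p ≠ 2 → ClassX3 W p → Additive.SubM W p →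
      ∀ (N : ℕ) [NeZero N] (K : Type) [Field K] [NumberField K]
        (Dt : ModularParametrizationData W N) (H : HeegnerDatum N (NumberField.discr K)) (ι : K →+* ℂ)
        (P : (W.baseChange K).toAffine.Point),
        W.analyticRank = 1 → Additive.N10.Locus W p → W.conductorNorm ℤ = N → IsImaginaryQuadratic K →
        Odd (NumberField.discr K) → ¬ p ∣ Units.torsionOrder K → SatisfiesHeegnerHypothesis N K →
        (W.quadraticTwist (NumberField.discr K : ℚ)).entireLFunction 1 ≠ 0 →
        WeierstrassCurve.Affine.Point.map ι.toRatAlgHom P = heegnerPointComplex Dt H →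
        ¬ IsOfFinAddOrder P → (∀ Q : (W.baseChange K).toAffine.Point, p • Q = 0 → Q = 0) →
        ∀ (κ : ZpExtension K p), κ.IsAnticyclotomic →
          ∀ (γ : Field.absoluteGaloisGroup K) [Fact (κ.IsTopGenerator γ)]
            (𝔭 : HeightOneSpectrum (𝓞 K)), ((p : ℕ) : 𝓞 K) ∈ 𝔭.asIdeal →
            𝔭.asIdeal.ramificationIdx (𝓞 ℚ) = 1 → 𝔭.asIdeal.inertiaDeg (𝓞 ℚ) = 1 →
            ∀ (ι' : PadicAlgCl p ≃+* ℂ), BranchInducesPrime p ι' 𝔭 →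
              ∃ (ΩK : ℂ) (Ωp : ℂ_[p]) (Q : PowerSeries (PadicComplexInt p)), ΩK ≠ 0 ∧ Ωp ≠ 0 ∧
                R1.IsBDPLFunctionInt p ι' 𝔭 κ γ Dt.f ΩK Ωp Q ∧
                  Ideal.span {Q} ≤
                    (XAc.charIdeal (W.baseChange K) p κ 𝔭 ∅ γ).map (PowerSeries.map (R1.toCpInt p))) :
    PotMultBranchCoIMC :=
  potMultBranchCoIMC_of_kolyvagin_of_hsieh_of_lzz_of_intCoDiv hKo hA hL
    (intCoDiv_of_exists_frame (fun W _ _ p _ => Additive.SubM W p) hM)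

/-- **Wing crux r3 `GordTwoBranchCoIMCField` ⇐ Kolyvagin ∧ Hsieh ∧ LZZ ∧ H3♭ᵒᵖ∃ on the (G-ord, `e = 2`) cell** (ONE ♭-frame per datum
with the co-divisibility — the shape a MATCHED Keller–Yin branch frame would deliver): §3 with `Cell := Additive.SubGordTwo` fed to
§2. CONDITIONAL; nothing closed. [cite: Hsieh2014, Thm. A p. 712 (Doc. Math. 19)]
[cite: LiuZhangZhang2018, Thm 1.5.1 and Thm 1.5.3 (Duke Math. J. 167 pp. 748–749)]
[cite: KellerYin2024b, Thm. 3.5.1 (arXiv:2410.23241 p. 20) (shape; preprint)] -/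
theorem gordTwoBranchCoIMCField_of_kolyvagin_of_hsieh_of_lzz_of_exists_intCoDiv
    (hKo : ∀ (N : ℕ) [NeZero N] (W : WeierstrassCurve ℚ) (K : Type) [Field K] [NumberField K],
      Literature.NumberTheory.EllipticCurves.kolyvagin N W K)
    (hA : Hsieh2014.thmA_exists_isHsiehLFunction_unrPeriod_anyLevel)
    (hL : LiuZhangZhang2018.thm151_thm153_modularCurve_heegnerVector_additive)
    (hG : ∀ (W : WeierstrassCurve ℚ) [W.IsElliptic] [W.IsGloballyMinimal] (p : ℕ) [Fact p.Prime],
      p ≠ 2 → ClassX3 W p → Additive.SubGordTwo W p →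
      ∀ (N : ℕ) [NeZero N] (K : Type) [Field K] [NumberField K]
        (Dt : ModularParametrizationData W N) (H : HeegnerDatum N (NumberField.discr K)) (ι : K →+* ℂ)
        (P : (W.baseChange K).toAffine.Point),
        W.analyticRank = 1 → Additive.N10.Locus W p → W.conductorNorm ℤ = N → IsImaginaryQuadratic K →
        Odd (NumberField.discr K) → ¬ p ∣ Units.torsionOrder K → SatisfiesHeegnerHypothesis N K →
        (W.quadraticTwist (NumberField.discr K : ℚ)).entireLFunction 1 ≠ 0 →
        WeierstrassCurve.Affine.Point.map ι.toRatAlgHom P = heegnerPointComplex Dt H →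
        ¬ IsOfFinAddOrder P → (∀ Q : (W.baseChange K).toAffine.Point, p • Q = 0 → Q = 0) →
        ∀ (κ : ZpExtension K p), κ.IsAnticyclotomic →
          ∀ (γ : Field.absoluteGaloisGroup K) [Fact (κ.IsTopGenerator γ)]
            (𝔭 : HeightOneSpectrum (𝓞 K)), ((p : ℕ) : 𝓞 K) ∈ 𝔭.asIdeal →
            𝔭.asIdeal.ramificationIdx (𝓞 ℚ) = 1 → 𝔭.asIdeal.inertiaDeg (𝓞 ℚ) = 1 →
            ∀ (ι' : PadicAlgCl p ≃+* ℂ), BranchInducesPrime p ι' 𝔭 →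
              ∃ (ΩK : ℂ) (Ωp : ℂ_[p]) (Q : PowerSeries (PadicComplexInt p)), ΩK ≠ 0 ∧ Ωp ≠ 0 ∧
                R1.IsBDPLFunctionInt p ι' 𝔭 κ γ Dt.f ΩK Ωp Q ∧
                  Ideal.span {Q} ≤
                    (XAc.charIdeal (W.baseChange K) p κ 𝔭 ∅ γ).map (PowerSeries.map (R1.toCpInt p))) :
    GordTwoBranchCoIMCField :=
  gordTwoBranchCoIMCField_of_kolyvagin_of_hsieh_of_lzz_of_intCoDiv hKo hA hL
    (intCoDiv_of_exists_frame (fun W _ _ p _ => Additive.SubGordTwo W p) hG)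

end Summit.BirchSwinnertonDyer.BirchSwinnertonDyer.Theorems.SchneiderFreeAdditiveX3.ControlDischarged

end
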